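import Mathlib
import HarnessLib
import Summits.NavierStokesRegularity.NavierStokesRegularity.Theorems.PoloidalWindowDoorLrcModEntireTwistingTHFlatRidgeCrossing

/-!
# Item `LrcModEntire` (stmt-NavierStokesRegularity-20428) — THE FLAT SUB-CELL ALONG A HOT ARC: tangent kernel, normal form with a UNIFORM slope, signed transversal quartic and its definiteness criterion at every arc point

ns-k2-port-2 g7, helper of item 20428 (LEAD lineage ns-poloidal-K2-p3; `--supports stmt-NavierStokesRegularity-20428 --as helper`).  Memo `Cruxes/LrcModEntire/T2B-g15.md` §17b/§17c.
The point files (`…FlatRidgeSecantPin` … `…FlatRidgeQuarticDefinite`) package the secant direction `T` and the slope `μ₀` EXISTENTIALLY at each hot point.  The LEAD g15 flat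
lever (`…TwistingTHFlatLeverPointwise` / `…FlatSeparation` / `…FlatChain`) works along a hot ARC `γ` with normal `ν(s) = Jγ′(s)` and asks the transversal forms `Q_s` to be
DEFINITE.  This file is the by-name bridge:

* `tangentKernel_of_hotArc` — along a differentiable hot arc `γ ⊂ P₀` (`γ′(s₀) ≠ 0`) the TANGENT is a kernel direction: `D⁴θ(γ s₀)[γ′(s₀), w, a, b] = 0` (all `a b w`) — the
  sequence form `…FlatRidgeCrossing.secantKernel_of_tendsto` on `γ(s₀ + 1/(n+1))`;
* `hessian_vertVert_eq_smul_uniform` — ONE slope `μ₀ ≤ 0` (the (TH) slope of `P₀`) serves EVERY flat hot point: `D²(∂₂²θ)(y) = −μ₀•D²(Δₕθ)(y)`;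
* `quarticNormalForm_of_kernel` (class-free) — for `f ∈ C⁴`, a unit horizontal kernel direction `T` of `D⁴f(y)` and the slaving identity ⇒ with `ν = JT`:
  `D⁴[c,d,e₂,e₂] = −μ₀D⁴[c,d,ν,ν]` (all `c d`) and `D⁴[e₂,e₂,e₂,e₂] = μ₀²D⁴[ν,ν,ν,ν]`; `quarticForm_expansion_of_kernel` (class-free) — then
  `D⁴f(y)[(nν+ze₂)⁴] = P(n⁴ − 6μ₀n²z² + μ₀²z⁴) + B₃(4n³z − 4μ₀nz³)`;
* `kernelQuarticForm_of_flatHotPoint` — the signed expansion at a flat hot point for a GIVEN kernel direction and slope identity;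
* ★ `arcQuarticForm_of_flatHotArc` — flat-cell binders VERBATIM + a differentiable hot arc `γ` in `P₀` with `‖deriv γ s‖ = 1`: **one `μ₀ ≤ 0` such that at EVERY `s`**, with
  `T = γ′(s)`, `ν = JT`, `P(s) = ∂_ν⁴θ(γ s)`, `B₃(s) = D⁴θ(γ s)[ν,ν,ν,e₂]`: the kernel, the expansion `F_s(n,z) = P(s)(n⁴ − 6μ₀n²z² + μ₀²z⁴) + B₃(s)(4n³z − 4μ₀nz³)` and the
  sign `σF_s ≤ 0` — so the LEAD lever's definiteness at `γ(s)` is decided by `…QuarticDefinite.quartic_definite_iff`: ⟺ `B₃(s)² < −μ₀P(s)²` (sequel `…FlatRidgeArcDefinite`).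

WHAT THIS IS NOT: not a claim about Navier–Stokes regularity and not a proof of `stub_T2bFlat`; structure of its hypothetical flat hot arcs (bears_on LADDER-NS N0, item 20428 /
crux 19708; OPEN).
-/

set_option linter.style.longLine false
set_option linter.dupNamespace false

namespace Summit.NavierStokesRegularity.NavierStokesRegularity.Theorems.PoloidalWindowDoorLrcModEntireTwistingTHFlatRidgeArcForm

open Set Function Filter Topology Metric
open scoped RealInnerProductSpace InnerProductSpace ContDiff Laplacian
open Literature.Analysis Literature.Analysis.FluidPDE Literature.Analysis.UnboundedOperators
open Summit.NavierStokesRegularity.NavierStokesRegularity.Theorems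
open Summit.NavierStokesRegularity.NavierStokesRegularity.Theorems.LocalSineTubeDoorProfileAlignedWindowRigidityAncient
open Summit.NavierStokesRegularity.NavierStokesRegularity.Theorems.PoloidalWindowDoorPoloidalWindowRigidityWindow
open Summit.NavierStokesRegularity.NavierStokesRegularity.Theorems.PoloidalWindowDoorPoloidalWindowRigidityConstantShearSlice
open Summit.NavierStokesRegularity.NavierStokesRegularity.Theorems.PoloidalWindowDoorPoloidalWindowRigidityTimeHeightShearLinearSlice
open Summit.NavierStokesRegularity.NavierStokesRegularity.Theorems.PoloidalWindowDoorLrcModEntireRidgeWiring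
open Summit.NavierStokesRegularity.NavierStokesRegularity.Theorems.PoloidalWindowDoorLrcModEntireTwistingTHSlopeSign
open Summit.NavierStokesRegularity.NavierStokesRegularity.Theorems.PoloidalWindowDoorLrcModEntireTwistingTHNonflatPlane
open Summit.NavierStokesRegularity.NavierStokesRegularity.Theorems.PoloidalWindowDoorLrcModEntireTwistingTHSlopeSlab
open Summit.NavierStokesRegularity.NavierStokesRegularity.Theorems.PoloidalWindowDoorLrcModEntireTwistingTHFlatRidgeJet
open Summit.NavierStokesRegularity.NavierStokesRegularity.Theorems.PoloidalWindowDoorLrcModEntireTwistingTHFlatRidgeThirdJet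
open Summit.NavierStokesRegularity.NavierStokesRegularity.Theorems.PoloidalWindowDoorLrcModEntireTwistingTHFlatRidgeSecantPin
open Summit.NavierStokesRegularity.NavierStokesRegularity.Theorems.PoloidalWindowDoorLrcModEntireTwistingTHFlatRidgeQuarticNormalForm
open Summit.NavierStokesRegularity.NavierStokesRegularity.Theorems.PoloidalWindowDoorLrcModEntireTwistingTHFlatRidgeQuarticForm
open Summit.NavierStokesRegularity.NavierStokesRegularity.Theorems.PoloidalWindowDoorLrcModEntireTwistingTHFlatRidgeCrossing

/-! ### Class-free: normal form and expansion from a GIVEN kernel direction -/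

section ClassFree

variable {f : EuclideanSpace ℝ (Fin 3) → ℝ} {y : EuclideanSpace ℝ (Fin 3)}

/-- **Normal form from a given kernel direction** (class-free core of `…QuarticNormalForm.quarticNormalForm_of_flatHotPoint`): `f ∈ C⁴`, `T` unit horizontal with
`D⁴f(y)[T,w,a,b] = 0` (all `a b w`), and the slaving identity `D²(∂₂²f)(y) = −μ₀•D²(∂₀²f + ∂₁²f)(y)` ⇒ with `ν = JT`: `D⁴[c,d,e₂,e₂] = −μ₀D⁴[c,d,ν,ν]` and
`D⁴[e₂,e₂,e₂,e₂] = μ₀²D⁴[ν,ν,ν,ν]`. -/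
theorem quarticNormalForm_of_kernel (hf : ContDiff ℝ 4 f) {μ₀ : ℝ}
    (hvv : fderiv ℝ (fderiv ℝ (fun x => fderiv ℝ (fderiv ℝ f) x (EuclideanSpace.single 2 1) (EuclideanSpace.single 2 1))) y =
      (-μ₀) • fderiv ℝ (fderiv ℝ (fun x => fderiv ℝ (fun x' => fderiv ℝ f x' (EuclideanSpace.single 0 1)) x (EuclideanSpace.single 0 1) +
        fderiv ℝ (fun x' => fderiv ℝ f x' (EuclideanSpace.single 1 1)) x (EuclideanSpace.single 1 1))) y)
    {T : EuclideanSpace ℝ (Fin 3)} (hT2 : T 2 = 0) (hT1 : ‖T‖ = 1)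
    (hker : ∀ a b w : EuclideanSpace ℝ (Fin 3), fderiv ℝ (fderiv ℝ (fun x => fderiv ℝ (fderiv ℝ f) x a b)) y T w = 0) :
    (∀ c d : EuclideanSpace ℝ (Fin 3), fderiv ℝ (fderiv ℝ (fun x => fderiv ℝ (fderiv ℝ f) x (EuclideanSpace.single 2 (1 : ℝ)) (EuclideanSpace.single 2 (1 : ℝ)))) y c d = (-μ₀) * fderiv ℝ (fderiv ℝ (fun x => fderiv ℝ (fderiv ℝ f) x ((-T 1) • EuclideanSpace.single 0 (1 : ℝ) + T 0 • EuclideanSpace.single 1 (1 : ℝ)) ((-T 1) • EuclideanSpace.single 0 (1 : ℝ) + T 0 • EuclideanSpace.single 1 (1 : ℝ)))) y c d) ∧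
      fderiv ℝ (fderiv ℝ (fun x => fderiv ℝ (fderiv ℝ f) x (EuclideanSpace.single 2 (1 : ℝ)) (EuclideanSpace.single 2 (1 : ℝ)))) y (EuclideanSpace.single 2 (1 : ℝ)) (EuclideanSpace.single 2 (1 : ℝ)) = μ₀ ^ 2 * fderiv ℝ (fderiv ℝ (fun x => fderiv ℝ (fderiv ℝ f) x ((-T 1) • EuclideanSpace.single 0 (1 : ℝ) + T 0 • EuclideanSpace.single 1 (1 : ℝ)) ((-T 1) • EuclideanSpace.single 0 (1 : ℝ) + T 0 • EuclideanSpace.single 1 (1 : ℝ)))) y ((-T 1) • EuclideanSpace.single 0 (1 : ℝ) + T 0 • EuclideanSpace.single 1 (1 : ℝ)) ((-T 1) • EuclideanSpace.single 0 (1 : ℝ) + T 0 • EuclideanSpace.single 1 (1 : ℝ)) := by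
  have hf2 : ContDiff ℝ 2 f := hf.of_le (by norm_num)
  set ν : EuclideanSpace ℝ (Fin 3) := (-T 1) • EuclideanSpace.single 0 (1 : ℝ) + T 0 • EuclideanSpace.single 1 (1 : ℝ) with hνdef
  set e₂ : EuclideanSpace ℝ (Fin 3) := EuclideanSpace.single 2 (1 : ℝ) with he₂
  -- the horizontal Laplacian's Hessian is the `(ν,ν)`-block
  have htrace : (fun x => fderiv ℝ (fun x' => fderiv ℝ f x' (EuclideanSpace.single 0 1)) x (EuclideanSpace.single 0 1) +
        fderiv ℝ (fun x' => fderiv ℝ f x' (EuclideanSpace.single 1 1)) x (EuclideanSpace.single 1 1)) =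
      fun x => fderiv ℝ (fderiv ℝ f) x ν ν + fderiv ℝ (fderiv ℝ f) x T T := by
    funext x
    rw [← fderiv_fderiv_eq_coord hf2 x, ← fderiv_fderiv_eq_coord hf2 x]
    exact horizTrace_eq (fderiv ℝ (fderiv ℝ f) x) hT2 hT1
  have hHνν : ContDiff ℝ 2 (fun x => fderiv ℝ (fderiv ℝ f) x ν ν) := contDiff_hessianEntry hf ν ν
  have hHTT : ContDiff ℝ 2 (fun x => fderiv ℝ (fderiv ℝ f) x T T) := contDiff_hessianEntry hf T T
  have hsplit : ∀ c d : EuclideanSpace ℝ (Fin 3),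
      fderiv ℝ (fderiv ℝ (fun x => fderiv ℝ (fun x' => fderiv ℝ f x' (EuclideanSpace.single 0 1)) x (EuclideanSpace.single 0 1) +
        fderiv ℝ (fun x' => fderiv ℝ f x' (EuclideanSpace.single 1 1)) x (EuclideanSpace.single 1 1))) y c d =
      fderiv ℝ (fderiv ℝ (fun x => fderiv ℝ (fderiv ℝ f) x ν ν)) y c d := by
    intro c d
    rw [htrace]
    have hd1 : ∀ x, DifferentiableAt ℝ (fun x => fderiv ℝ (fderiv ℝ f) x ν ν) x := fun x => (hHνν.differentiable (by norm_num)) x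
    have hd2 : ∀ x, DifferentiableAt ℝ (fun x => fderiv ℝ (fderiv ℝ f) x T T) x := fun x => (hHTT.differentiable (by norm_num)) x
    have e1 : fderiv ℝ (fun x => fderiv ℝ (fderiv ℝ f) x ν ν + fderiv ℝ (fderiv ℝ f) x T T) =
        fderiv ℝ (fun x => fderiv ℝ (fderiv ℝ f) x ν ν) + fderiv ℝ (fun x => fderiv ℝ (fderiv ℝ f) x T T) := by
      funext x; exact fderiv_fun_add (hd1 x) (hd2 x)
    have hD1 : DifferentiableAt ℝ (fderiv ℝ (fun x => fderiv ℝ (fderiv ℝ f) x ν ν)) y :=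
      ((hHνν.fderiv_right (m := 1) (by norm_num)).differentiable one_ne_zero) y
    have hD2 : DifferentiableAt ℝ (fderiv ℝ (fun x => fderiv ℝ (fderiv ℝ f) x T T)) y :=
      ((hHTT.fderiv_right (m := 1) (by norm_num)).differentiable one_ne_zero) y
    rw [e1, fderiv_add hD1 hD2]
    simp only [add_apply]
    have hTT : fderiv ℝ (fderiv ℝ (fun x => fderiv ℝ (fderiv ℝ f) x T T)) y c d = 0 := by
      rw [fourthDeriv_symm_middle hf T T c d, fourthDeriv_symm_outer hf d T c T]
      exact hker d T c
    rw [hTT, add_zero]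
  have hii : ∀ c d : EuclideanSpace ℝ (Fin 3), fderiv ℝ (fderiv ℝ (fun x => fderiv ℝ (fderiv ℝ f) x e₂ e₂)) y c d =
      (-μ₀) * fderiv ℝ (fderiv ℝ (fun x => fderiv ℝ (fderiv ℝ f) x ν ν)) y c d := by
    intro c d
    have h := congrArg (fun B : EuclideanSpace ℝ (Fin 3) →L[ℝ] EuclideanSpace ℝ (Fin 3) →L[ℝ] ℝ => B c d) hvv
    simp only [smul_apply, smul_eq_mul] at h
    rw [he₂, h, hsplit c d]
  refine ⟨hii, ?_⟩
  have hsym : fderiv ℝ (fderiv ℝ (fun x => fderiv ℝ (fderiv ℝ f) x ν ν)) y e₂ e₂ = fderiv ℝ (fderiv ℝ (fun x => fderiv ℝ (fderiv ℝ f) x e₂ e₂)) y ν ν := by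
    rw [fourthDeriv_symm_middle hf ν ν e₂ e₂, fourthDeriv_symm_outer hf e₂ ν e₂ ν, fourthDeriv_symm_inner hf e₂ ν,
      fourthDeriv_symm_middle hf ν e₂ ν e₂]
  rw [hii e₂ e₂, hsym, hii ν ν]
  ring

/-- **Expansion from a given kernel direction** (class-free): under the conclusions of `quarticNormalForm_of_kernel`, for all `n z`,
`D⁴f(y)[(nν+ze₂)⁴] = P(n⁴ − 6μ₀n²z² + μ₀²z⁴) + B₃(4n³z − 4μ₀nz³)` with `P = D⁴[ν,ν,ν,ν]`, `B₃ = D⁴[ν,e₂,ν,ν]`. -/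
theorem quarticForm_expansion_of_kernel (hf : ContDiff ℝ 4 f) {μ₀ : ℝ} {T : EuclideanSpace ℝ (Fin 3)}
    (hii : ∀ c d : EuclideanSpace ℝ (Fin 3), fderiv ℝ (fderiv ℝ (fun x => fderiv ℝ (fderiv ℝ f) x (EuclideanSpace.single 2 (1 : ℝ)) (EuclideanSpace.single 2 (1 : ℝ)))) y c d = (-μ₀) * fderiv ℝ (fderiv ℝ (fun x => fderiv ℝ (fderiv ℝ f) x ((-T 1) • EuclideanSpace.single 0 (1 : ℝ) + T 0 • EuclideanSpace.single 1 (1 : ℝ)) ((-T 1) • EuclideanSpace.single 0 (1 : ℝ) + T 0 • EuclideanSpace.single 1 (1 : ℝ)))) y c d)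
    (hiii : fderiv ℝ (fderiv ℝ (fun x => fderiv ℝ (fderiv ℝ f) x (EuclideanSpace.single 2 (1 : ℝ)) (EuclideanSpace.single 2 (1 : ℝ)))) y (EuclideanSpace.single 2 (1 : ℝ)) (EuclideanSpace.single 2 (1 : ℝ)) = μ₀ ^ 2 * fderiv ℝ (fderiv ℝ (fun x => fderiv ℝ (fderiv ℝ f) x ((-T 1) • EuclideanSpace.single 0 (1 : ℝ) + T 0 • EuclideanSpace.single 1 (1 : ℝ)) ((-T 1) • EuclideanSpace.single 0 (1 : ℝ) + T 0 • EuclideanSpace.single 1 (1 : ℝ)))) y ((-T 1) • EuclideanSpace.single 0 (1 : ℝ) + T 0 • EuclideanSpace.single 1 (1 : ℝ)) ((-T 1) • EuclideanSpace.single 0 (1 : ℝ) + T 0 • EuclideanSpace.single 1 (1 : ℝ))) (n z : ℝ) :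
    fderiv ℝ (fderiv ℝ (fun x => fderiv ℝ (fderiv ℝ f) x (n • ((-T 1) • EuclideanSpace.single 0 (1 : ℝ) + T 0 • EuclideanSpace.single 1 (1 : ℝ)) + z • (EuclideanSpace.single 2 (1 : ℝ))) (n • ((-T 1) • EuclideanSpace.single 0 (1 : ℝ) + T 0 • EuclideanSpace.single 1 (1 : ℝ)) + z • (EuclideanSpace.single 2 (1 : ℝ))))) y (n • ((-T 1) • EuclideanSpace.single 0 (1 : ℝ) + T 0 • EuclideanSpace.single 1 (1 : ℝ)) + z • (EuclideanSpace.single 2 (1 : ℝ))) (n • ((-T 1) • EuclideanSpace.single 0 (1 : ℝ) + T 0 • EuclideanSpace.single 1 (1 : ℝ)) + z • (EuclideanSpace.single 2 (1 : ℝ))) =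
      fderiv ℝ (fderiv ℝ (fun x => fderiv ℝ (fderiv ℝ f) x ((-T 1) • EuclideanSpace.single 0 (1 : ℝ) + T 0 • EuclideanSpace.single 1 (1 : ℝ)) ((-T 1) • EuclideanSpace.single 0 (1 : ℝ) + T 0 • EuclideanSpace.single 1 (1 : ℝ)))) y ((-T 1) • EuclideanSpace.single 0 (1 : ℝ) + T 0 • EuclideanSpace.single 1 (1 : ℝ)) ((-T 1) • EuclideanSpace.single 0 (1 : ℝ) + T 0 • EuclideanSpace.single 1 (1 : ℝ)) * (n ^ 4 - 6 * μ₀ * (n ^ 2 * z ^ 2) + μ₀ ^ 2 * z ^ 4) +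
        fderiv ℝ (fderiv ℝ (fun x => fderiv ℝ (fderiv ℝ f) x ((-T 1) • EuclideanSpace.single 0 (1 : ℝ) + T 0 • EuclideanSpace.single 1 (1 : ℝ)) ((-T 1) • EuclideanSpace.single 0 (1 : ℝ) + T 0 • EuclideanSpace.single 1 (1 : ℝ)))) y ((-T 1) • EuclideanSpace.single 0 (1 : ℝ) + T 0 • EuclideanSpace.single 1 (1 : ℝ)) (EuclideanSpace.single 2 (1 : ℝ)) * (4 * (n ^ 3 * z) - 4 * μ₀ * (n * z ^ 3)) := by
  rw [fourthDeriv_diag_expand hf ((-T 1) • EuclideanSpace.single 0 (1 : ℝ) + T 0 • EuclideanSpace.single 1 (1 : ℝ)) (EuclideanSpace.single 2 (1 : ℝ)) n z, hii, hii, hiii]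
  ring

end ClassFree

/-! ### In the class: one slope for all flat hot points; the tangent kernel along a hot arc -/

variable {C : ℝ} {v : ℝ → EuclideanSpace ℝ (Fin 3) → EuclideanSpace ℝ (Fin 3)}

/-- **ONE SLOPE SERVES EVERY FLAT HOT POINT**: `∃ μ₀ ≤ 0` (the (TH) slope of `P₀` at `t = −1`) with `D²(x ↦ D²θ(x)[e₂][e₂])(y) = −μ₀•D²(Δₕθ)(y)` at every flat hot point
`y ∈ P₀` (uniform version of `…QuarticNormalForm.hessian_vertVert_eq_smul_hessian_horizLaplacian_of_flatHotPoint`; same proof, the slope function chosen once). -/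
theorem hessian_vertVert_eq_smul_uniform (hdec : HasTypeITimeDecay C v) (hcont : ContinuousOn (uncurry v) (Iio (0 : ℝ) ×ˢ univ))
    (hmild : ∀ s t : ℝ, s < t → t < 0 → ∀ x, v t x = heatExtension (v s) (t - s) x - oseenDuhamel 1 s v v t x)
    (hdiv : ∀ t < 0, VectorCalculus.IsDivFree (v t))
    (hpol : ∀ s < 0, ∀ y, ⟪curl (v s) y, EuclideanSpace.single 2 1⟫_ℝ = 0)
    (hTH : ∀ t < 0, ∀ x x' : EuclideanSpace ℝ (Fin 3), x 2 = x' 2 → ∀ b c : Fin 3, b ≠ 2 → c ≠ 2 →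
      fderiv ℝ (v t) x (EuclideanSpace.single 2 1) b * fderiv ℝ (v t) x' (EuclideanSpace.single c 1) 2 =
        fderiv ℝ (v t) x' (EuclideanSpace.single 2 1) c * fderiv ℝ (v t) x (EuclideanSpace.single b 1) 2)
    (hne : v (-1) 0 2 ≠ 0) (hhot : ∀ t < 0, ∀ x, Real.sqrt (-t) * |v t x 2| ≤ |v (-1) 0 2|)
    (hproper : ∀ y ∈ {y : EuclideanSpace ℝ (Fin 3) | y 2 = 0 ∧ v (-1) y 2 = v (-1) 0 2}, ∀ r : ℝ, 0 < r →
      ∃ y' : EuclideanSpace ℝ (Fin 3), y' 2 = 0 ∧ dist y' y < r ∧ v (-1) y' 2 ≠ v (-1) 0 2)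
    {σ : ℝ} (hσN : σ * v (-1) 0 2 = |v (-1) 0 2|) :
    ∃ μ₀ : ℝ, μ₀ ≤ 0 ∧ ∀ y : EuclideanSpace ℝ (Fin 3), y 2 = 0 → v (-1) y 2 = v (-1) 0 2 →
      fderiv ℝ (fderiv ℝ (fun x => σ * v (-1) x 2)) y (EuclideanSpace.single 0 1) (EuclideanSpace.single 0 1) +
        fderiv ℝ (fderiv ℝ (fun x => σ * v (-1) x 2)) y (EuclideanSpace.single 1 1) (EuclideanSpace.single 1 1) = 0 →
      fderiv ℝ (fderiv ℝ (fun x => fderiv ℝ (fderiv ℝ (fun x' => (v (-1) x' 2 : ℝ))) x (EuclideanSpace.single 2 1) (EuclideanSpace.single 2 1))) y =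
        (-μ₀) • fderiv ℝ (fderiv ℝ (fun x => fderiv ℝ (fun x' => fderiv ℝ (fun y' => (v (-1) y' 2 : ℝ)) x' (EuclideanSpace.single 0 1)) x (EuclideanSpace.single 0 1) +
          fderiv ℝ (fun x' => fderiv ℝ (fun y' => (v (-1) y' 2 : ℝ)) x' (EuclideanSpace.single 1 1)) x (EuclideanSpace.single 1 1))) y := by
  have h1 : (-1 : ℝ) < 0 := by norm_num
  have hA : IsTypeIAncientMild C v := isTypeIAncientMild_of_class hdec hcont hmild hdiv
  have hs : ContDiff ℝ ∞ (v (-1)) := hA.contDiff_slice h1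
  have hsd : Differentiable ℝ (v (-1)) := hs.differentiable (by simp)
  set θ : EuclideanSpace ℝ (Fin 3) → ℝ := fun x => v (-1) x 2 with hθdef
  have hθ : ContDiff ℝ ∞ θ := contDiff_two_component hdec hcont hmild
  have hθ2 : ContDiff ℝ 2 θ := hθ.of_le (by exact WithTop.coe_le_coe.2 le_top)
  have hθ3 : ContDiff ℝ 3 θ := hθ.of_le (by exact WithTop.coe_le_coe.2 le_top)
  -- ## the slope function on a uniform slab and its sign
  have h02 : (0 : EuclideanSpace ℝ (Fin 3)) 2 = 0 := rfl
  obtain ⟨y', hy'2, -, hy'ne⟩ := hproper 0 ⟨h02, rfl⟩ 1 one_pos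
  obtain ⟨y₁, hy₁, c₁, hc₁, hne₁⟩ := exists_fderiv_two_ne_zero_of_properRidge hsd ⟨y', hy'2, hy'ne⟩
  obtain ⟨μ, ρ, hρ, hμ3, hslab, hnear, -⟩ := exists_slopeFunction_slab hdec hcont hmild hTH hy₁ hc₁ hne₁
  have hμ0 : μ (-1) 0 ≤ 0 := slopeFunction_nonpos hdec hcont hmild hdiv hpol hne hhot hμ3.continuous (hnear 0 h02)
  refine ⟨μ (-1) 0, hμ0, fun y hy0 hy hflat => ?_⟩
  -- ## the slab slice law `∂₂∂₂θ(x) = −μ(−1,x₂)·Δₕθ(x)` for `|x₂| < ρ`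
  have hdivpt : ∀ x : EuclideanSpace ℝ (Fin 3), fderiv ℝ (v (-1)) x (EuclideanSpace.single 0 (1 : ℝ)) 0 +
      fderiv ℝ (v (-1)) x (EuclideanSpace.single 1 (1 : ℝ)) 1 + fderiv ℝ (v (-1)) x (EuclideanSpace.single 2 (1 : ℝ)) 2 = 0 :=
    fun x => div_coord (hdiv (-1) h1) x
  set L : EuclideanSpace ℝ (Fin 3) → ℝ := fun x => fderiv ℝ (fun x' => fderiv ℝ θ x' (EuclideanSpace.single 0 1)) x (EuclideanSpace.single 0 1) +
    fderiv ℝ (fun x' => fderiv ℝ θ x' (EuclideanSpace.single 1 1)) x (EuclideanSpace.single 1 1) with hLdef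
  set m : EuclideanSpace ℝ (Fin 3) → ℝ := fun x => -μ (-1) (x 2) with hmdef
  have hlaw : ∀ x : EuclideanSpace ℝ (Fin 3), |x 2| < ρ →
      fderiv ℝ (fun x' => fderiv ℝ θ x' (EuclideanSpace.single 2 1)) x (EuclideanSpace.single 2 1) = m x * L x := by
    intro x hx
    have hslope : ∀ w : EuclideanSpace ℝ (Fin 3), w 2 = x 2 → ∀ b : Fin 3, b ≠ 2 →
        fderiv ℝ (v (-1)) w (EuclideanSpace.single 2 (1 : ℝ)) b = μ (-1) (x 2) * fderiv ℝ (v (-1)) w (EuclideanSpace.single b (1 : ℝ)) 2 := by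
      intro w hw b hb
      have h := hslab (-1) (by norm_num; exact hρ) w (by rw [hw]; exact hx) b hb
      rw [hw] at h
      exact h
    have h := plane_wave_identity (hs.of_le (by norm_cast)) hdivpt hslope (rfl : x 2 = x 2)
    rw [hmdef, hLdef, hθdef]
    simp only
    exact h
  -- ## as an eventual identity near `y`
  have hU : {x : EuclideanSpace ℝ (Fin 3) | |x 2| < ρ} ∈ 𝓝 y := by
    have hc : Continuous fun x : EuclideanSpace ℝ (Fin 3) => |x 2| := ((EuclideanSpace.proj (2 : Fin 3)).continuous).abs
    exact (isOpen_lt hc continuous_const).mem_nhds (by show |y 2| < ρ; rw [hy0, abs_zero]; exact hρ)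
  have hev : (fun x => fderiv ℝ (fun x' => fderiv ℝ θ x' (EuclideanSpace.single 2 1)) x (EuclideanSpace.single 2 1)) =ᶠ[𝓝 y] fun x => m x * L x := by
    filter_upwards [hU] with x hx using hlaw x hx
  -- ## regularity of `m` and `L`, and the flat data `L(y) = 0`, `DL(y) = 0`
  have hm : ContDiff ℝ 2 m := by
    have h1' : ContDiff ℝ 3 (fun x : EuclideanSpace ℝ (Fin 3) => μ (-1) (x 2)) :=
      hμ3.comp (contDiff_const.prodMk (EuclideanSpace.proj (𝕜 := ℝ) (2 : Fin 3)).contDiff)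
    rw [hmdef]; exact (h1'.of_le (by norm_num)).neg
  have hsec : ∀ e : EuclideanSpace ℝ (Fin 3), ContDiff ℝ 2 (fun x => fderiv ℝ (fun x' => fderiv ℝ θ x' e) x e) := fun e =>
    ((((hθ.fderiv_right (m := ∞) (by norm_cast)).clm_apply contDiff_const).fderiv_right (m := ∞) (by norm_cast)).clm_apply contDiff_const).of_le
      (by exact WithTop.coe_le_coe.2 le_top)
  have hLc : ContDiff ℝ 2 L := by rw [hLdef]; exact (hsec _).add (hsec _)
  have hH := hessian_two_eq_zero_of_flatHotPoint hdec hcont hmild hdiv hTH hne hhot hproper hσN hy0 hy hflat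
  have h3 := thirdDeriv_two_eq_zero_of_flatHotPoint hdec hcont hmild hdiv hTH hne hhot hproper hσN hy0 hy hflat
  have hentry0 : ∀ e : EuclideanSpace ℝ (Fin 3), fderiv ℝ (fun x' => fderiv ℝ θ x' e) y e = 0 := fun e => by
    rw [← fderiv_fderiv_eq_coord hθ2 y e e, hθdef, hH]; simp
  have hentry1 : ∀ e : EuclideanSpace ℝ (Fin 3), fderiv ℝ (fun x => fderiv ℝ (fun x' => fderiv ℝ θ x' e) x e) y = 0 := fun e => by
    ext w
    have hF : ContDiff ℝ 2 (fun x' => fderiv ℝ θ x' e) := (hθ3.fderiv_right (m := 2) (by norm_num)).clm_apply contDiff_const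
    rw [← fderiv_fderiv_eq_coord hF y w e, fderiv_fderiv_fderiv_apply_eq hθ3 y w e e, hθdef, h3]
    simp
  have hL0 : L y = 0 := by rw [hLdef]; simp only; rw [hentry0, hentry0, add_zero]
  have hL1 : fderiv ℝ L y = 0 := by
    have hd : ∀ e, DifferentiableAt ℝ (fun x => fderiv ℝ (fun x' => fderiv ℝ θ x' e) x e) y := fun e => ((hsec e).differentiable (by norm_num)) y
    rw [hLdef, fderiv_fun_add (hd _) (hd _), hentry1, hentry1, add_zero]
  -- ## conclude
  have hlhs : (fun x => fderiv ℝ (fderiv ℝ θ) x (EuclideanSpace.single 2 1) (EuclideanSpace.single 2 1)) =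
      fun x => fderiv ℝ (fun x' => fderiv ℝ θ x' (EuclideanSpace.single 2 1)) x (EuclideanSpace.single 2 1) :=
    funext fun x => fderiv_fderiv_eq_coord hθ2 x _ _
  rw [hθdef] at hlhs
  rw [hlhs, (hev.fderiv (𝕜 := ℝ)).fderiv_eq (𝕜 := ℝ), fderiv_fderiv_mul_of_flat hm hLc hL0 hL1]
  rw [hmdef, hLdef, hθdef]
  simp only [hy0]

/-- **THE TANGENT OF A HOT ARC IS A KERNEL DIRECTION.**  Flat-cell binders (as `…FlatRidgeCrossing.secantKernel_of_tendsto`), a map `γ : ℝ → P₀` through hot points with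
`HasDerivAt γ γ′ s₀`, `γ′ ≠ 0` ⇒ `D²(x ↦ D²θ(x)[a][b])(γ s₀)[γ′][w] = 0` for all `a b w` (secants of `γ(s₀ + 1/(n+1))` normalise to `γ′/‖γ′‖`; the kernel is linear in `T`). -/
theorem tangentKernel_of_hotArc (hdec : HasTypeITimeDecay C v) (hcont : ContinuousOn (uncurry v) (Iio (0 : ℝ) ×ˢ univ))
    (hmild : ∀ s t : ℝ, s < t → t < 0 → ∀ x, v t x = heatExtension (v s) (t - s) x - oseenDuhamel 1 s v v t x)
    (hdiv : ∀ t < 0, VectorCalculus.IsDivFree (v t))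
    (hTH : ∀ t < 0, ∀ x x' : EuclideanSpace ℝ (Fin 3), x 2 = x' 2 → ∀ b c : Fin 3, b ≠ 2 → c ≠ 2 →
      fderiv ℝ (v t) x (EuclideanSpace.single 2 1) b * fderiv ℝ (v t) x' (EuclideanSpace.single c 1) 2 =
        fderiv ℝ (v t) x' (EuclideanSpace.single 2 1) c * fderiv ℝ (v t) x (EuclideanSpace.single b 1) 2)
    (hne : v (-1) 0 2 ≠ 0) (hhot : ∀ t < 0, ∀ x, Real.sqrt (-t) * |v t x 2| ≤ |v (-1) 0 2|)
    (hproper : ∀ y ∈ {y : EuclideanSpace ℝ (Fin 3) | y 2 = 0 ∧ v (-1) y 2 = v (-1) 0 2}, ∀ r : ℝ, 0 < r →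
      ∃ y' : EuclideanSpace ℝ (Fin 3), y' 2 = 0 ∧ dist y' y < r ∧ v (-1) y' 2 ≠ v (-1) 0 2)
    {σ : ℝ} (hσN : σ * v (-1) 0 2 = |v (-1) 0 2|)
    (hflatAll : ∀ y : EuclideanSpace ℝ (Fin 3), y 2 = 0 → v (-1) y 2 = v (-1) 0 2 →
      fderiv ℝ (fderiv ℝ (fun x => σ * v (-1) x 2)) y (EuclideanSpace.single 0 1) (EuclideanSpace.single 0 1) +
        fderiv ℝ (fderiv ℝ (fun x => σ * v (-1) x 2)) y (EuclideanSpace.single 1 1) (EuclideanSpace.single 1 1) = 0)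
    {γ : ℝ → EuclideanSpace ℝ (Fin 3)} (hγ2 : ∀ s, γ s 2 = 0) (hγv : ∀ s, v (-1) (γ s) 2 = v (-1) 0 2)
    {s₀ : ℝ} {γ' : EuclideanSpace ℝ (Fin 3)} (hγ : HasDerivAt γ γ' s₀) (hγ' : γ' ≠ 0) (a b w : EuclideanSpace ℝ (Fin 3)) :
    fderiv ℝ (fderiv ℝ (fun x => fderiv ℝ (fderiv ℝ (fun x' => (v (-1) x' 2 : ℝ))) x a b)) (γ s₀) γ' w = 0 := by
  -- the hot sequence `z n = γ(s₀ + hₙ)`, `hₙ = 1/(n+1)`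
  set hs : ℕ → ℝ := fun n => 1 / ((n : ℝ) + 1) with hhs
  have hpos : ∀ n, 0 < hs n := fun n => by rw [hhs]; positivity
  have hto0 : Tendsto hs atTop (𝓝 0) := tendsto_one_div_add_atTop_nhds_zero_nat
  have hto0' : Tendsto hs atTop (𝓝[>] 0) :=
    tendsto_nhdsWithin_iff.2 ⟨hto0, Eventually.of_forall fun n => hpos n⟩
  set z : ℕ → EuclideanSpace ℝ (Fin 3) := fun n => γ (s₀ + hs n) with hz
  have hzt : Tendsto z atTop (𝓝 (γ s₀)) := by
    have hc : Tendsto (fun n => s₀ + hs n) atTop (𝓝 s₀) := by simpa using tendsto_const_nhds.add hto0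
    exact hγ.continuousAt.tendsto.comp hc
  -- difference quotients converge to `γ′`
  have hq : Tendsto (fun n => (hs n)⁻¹ • (z n - γ s₀)) atTop (𝓝 γ') := hγ.tendsto_slope_zero_right.comp hto0'
  -- normalised secants converge to `γ′/‖γ′‖`
  have hN : ContinuousAt (fun u : EuclideanSpace ℝ (Fin 3) => ‖u‖⁻¹ • u) γ' :=
    ((continuous_norm.continuousAt).inv₀ (norm_ne_zero_iff.2 hγ')).smul continuousAt_id
  have heq : (fun n => ‖z n - γ s₀‖⁻¹ • (z n - γ s₀)) = fun n => ‖(hs n)⁻¹ • (z n - γ s₀)‖⁻¹ • ((hs n)⁻¹ • (z n - γ s₀)) := by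
    funext n
    rw [norm_smul, norm_inv, Real.norm_of_nonneg (hpos n).le, smul_smul, mul_inv, inv_inv,
      mul_comm (hs n) _, mul_assoc, mul_inv_cancel₀ (hpos n).ne', mul_one]
  have hlim : Tendsto (fun n => ‖z (id n) - γ s₀‖⁻¹ • (z (id n) - γ s₀)) atTop (𝓝 (‖γ'‖⁻¹ • γ')) := by
    show Tendsto (fun n => ‖z n - γ s₀‖⁻¹ • (z n - γ s₀)) atTop (𝓝 (‖γ'‖⁻¹ • γ'))
    rw [heq]
    exact hN.tendsto.comp hq
  have hker := secantKernel_of_tendsto hdec hcont hmild hdiv hTH hne hhot hproper hσN hflatAll (hγ2 s₀) (hγv s₀)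
    (z := z) (fun n => hγ2 _) (fun n => hγv _) hzt strictMono_id hlim a b w
  rw [map_smul, smul_apply, smul_eq_mul] at hker
  exact (mul_eq_zero.1 hker).resolve_left (inv_ne_zero (norm_ne_zero_iff.2 hγ'))

/-! ### Point version with a GIVEN kernel direction, and the arc package -/

/-- **THE SIGNED QUARTIC AND ITS DEFINITENESS AT A FLAT HOT POINT, FOR A GIVEN KERNEL DIRECTION.**  Flat-cell binders (no «no compact isolated piece» needed here), a flat hot point
`y ∈ P₀`, the slaving identity at `y` with slope `μ₀` (e.g. from `hessian_vertVert_eq_smul_uniform`), and a unit horizontal `T` with `D⁴θ(y)[T,w,a,b] = 0` ⇒ with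
`ν = JT`, `F(n,z) = D⁴θ(y)[(nν+ze₂)⁴]`, `P = D⁴[ν,ν,ν,ν]`, `B₃ = D⁴[ν,e₂,ν,ν]`: the expansion `F = P(n⁴ − 6μ₀n²z² + μ₀²z⁴) + B₃(4n³z − 4μ₀nz³)` and the sign `σF ≤ 0`. -/
theorem kernelQuarticForm_of_flatHotPoint (hdec : HasTypeITimeDecay C v) (hcont : ContinuousOn (uncurry v) (Iio (0 : ℝ) ×ˢ univ))
    (hmild : ∀ s t : ℝ, s < t → t < 0 → ∀ x, v t x = heatExtension (v s) (t - s) x - oseenDuhamel 1 s v v t x)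
    (hdiv : ∀ t < 0, VectorCalculus.IsDivFree (v t))
    (hTH : ∀ t < 0, ∀ x x' : EuclideanSpace ℝ (Fin 3), x 2 = x' 2 → ∀ b c : Fin 3, b ≠ 2 → c ≠ 2 →
      fderiv ℝ (v t) x (EuclideanSpace.single 2 1) b * fderiv ℝ (v t) x' (EuclideanSpace.single c 1) 2 =
        fderiv ℝ (v t) x' (EuclideanSpace.single 2 1) c * fderiv ℝ (v t) x (EuclideanSpace.single b 1) 2)
    (hne : v (-1) 0 2 ≠ 0) (hhot : ∀ t < 0, ∀ x, Real.sqrt (-t) * |v t x 2| ≤ |v (-1) 0 2|)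
    (hproper : ∀ y ∈ {y : EuclideanSpace ℝ (Fin 3) | y 2 = 0 ∧ v (-1) y 2 = v (-1) 0 2}, ∀ r : ℝ, 0 < r →
      ∃ y' : EuclideanSpace ℝ (Fin 3), y' 2 = 0 ∧ dist y' y < r ∧ v (-1) y' 2 ≠ v (-1) 0 2)
    {σ : ℝ} (hσN : σ * v (-1) 0 2 = |v (-1) 0 2|)
    (hflatAll : ∀ y : EuclideanSpace ℝ (Fin 3), y 2 = 0 → v (-1) y 2 = v (-1) 0 2 →
      fderiv ℝ (fderiv ℝ (fun x => σ * v (-1) x 2)) y (EuclideanSpace.single 0 1) (EuclideanSpace.single 0 1) +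
        fderiv ℝ (fderiv ℝ (fun x => σ * v (-1) x 2)) y (EuclideanSpace.single 1 1) (EuclideanSpace.single 1 1) = 0)
    {y : EuclideanSpace ℝ (Fin 3)} (hy0 : y 2 = 0) (hy : v (-1) y 2 = v (-1) 0 2) {μ₀ : ℝ}
    (hvv : fderiv ℝ (fderiv ℝ (fun x => fderiv ℝ (fderiv ℝ (fun x' => (v (-1) x' 2 : ℝ))) x (EuclideanSpace.single 2 1) (EuclideanSpace.single 2 1))) y =
      (-μ₀) • fderiv ℝ (fderiv ℝ (fun x => fderiv ℝ (fun x' => fderiv ℝ (fun y' => (v (-1) y' 2 : ℝ)) x' (EuclideanSpace.single 0 1)) x (EuclideanSpace.single 0 1) +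
        fderiv ℝ (fun x' => fderiv ℝ (fun y' => (v (-1) y' 2 : ℝ)) x' (EuclideanSpace.single 1 1)) x (EuclideanSpace.single 1 1))) y)
    {T : EuclideanSpace ℝ (Fin 3)} (hT2 : T 2 = 0) (hT1 : ‖T‖ = 1)
    (hker : ∀ a b w : EuclideanSpace ℝ (Fin 3), fderiv ℝ (fderiv ℝ (fun x => fderiv ℝ (fderiv ℝ (fun x' => (v (-1) x' 2 : ℝ))) x a b)) y T w = 0) :
    ∀ n z : ℝ,
        fderiv ℝ (fderiv ℝ (fun x => fderiv ℝ (fderiv ℝ (fun x' => (v (-1) x' 2 : ℝ))) x (n • ((-T 1) • EuclideanSpace.single 0 (1 : ℝ) + T 0 • EuclideanSpace.single 1 (1 : ℝ)) + z • (EuclideanSpace.single 2 (1 : ℝ))) (n • ((-T 1) • EuclideanSpace.single 0 (1 : ℝ) + T 0 • EuclideanSpace.single 1 (1 : ℝ)) + z • (EuclideanSpace.single 2 (1 : ℝ))))) y (n • ((-T 1) • EuclideanSpace.single 0 (1 : ℝ) + T 0 • EuclideanSpace.single 1 (1 : ℝ)) + z • (EuclideanSpace.single 2 (1 : ℝ)))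 (n • ((-T 1) • EuclideanSpace.single 0 (1 : ℝ) + T 0 • EuclideanSpace.single 1 (1 : ℝ)) + z • (EuclideanSpace.single 2 (1 : ℝ))) =
          fderiv ℝ (fderiv ℝ (fun x => fderiv ℝ (fderiv ℝ (fun x' => (v (-1) x' 2 : ℝ))) x ((-T 1) • EuclideanSpace.single 0 (1 : ℝ) + T 0 • EuclideanSpace.single 1 (1 : ℝ)) ((-T 1) • EuclideanSpace.single 0 (1 : ℝ) + T 0 • EuclideanSpace.single 1 (1 : ℝ)))) y ((-T 1) • EuclideanSpace.single 0 (1 : ℝ) + T 0 • EuclideanSpace.single 1 (1 : ℝ)) ((-T 1) • EuclideanSpace.single 0 (1 : ℝ) + T 0 • EuclideanSpace.single 1 (1 : ℝ)) * (n ^ 4 - 6 * μ₀ * (n ^ 2 * z ^ 2) + μ₀ ^ 2 * z ^ 4) +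
            fderiv ℝ (fderiv ℝ (fun x => fderiv ℝ (fderiv ℝ (fun x' => (v (-1) x' 2 : ℝ))) x ((-T 1) • EuclideanSpace.single 0 (1 : ℝ) + T 0 • EuclideanSpace.single 1 (1 : ℝ)) ((-T 1) • EuclideanSpace.single 0 (1 : ℝ) + T 0 • EuclideanSpace.single 1 (1 : ℝ)))) y ((-T 1) • EuclideanSpace.single 0 (1 : ℝ) + T 0 • EuclideanSpace.single 1 (1 : ℝ)) (EuclideanSpace.single 2 (1 : ℝ)) * (4 * (n ^ 3 * z) - 4 * μ₀ * (n * z ^ 3)) ∧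
        σ * fderiv ℝ (fderiv ℝ (fun x => fderiv ℝ (fderiv ℝ (fun x' => (v (-1) x' 2 : ℝ))) x (n • ((-T 1) • EuclideanSpace.single 0 (1 : ℝ) + T 0 • EuclideanSpace.single 1 (1 : ℝ)) + z • (EuclideanSpace.single 2 (1 : ℝ))) (n • ((-T 1) • EuclideanSpace.single 0 (1 : ℝ) + T 0 • EuclideanSpace.single 1 (1 : ℝ)) + z • (EuclideanSpace.single 2 (1 : ℝ))))) y (n • ((-T 1) • EuclideanSpace.single 0 (1 : ℝ) + T 0 • EuclideanSpace.single 1 (1 : ℝ)) + z • (EuclideanSpace.single 2 (1 : ℝ))) (n • ((-T 1) • EuclideanSpace.single 0 (1 : ℝ) + T 0 • EuclideanSpace.single 1 (1 : ℝ)) + z • (EuclideanSpace.single 2 (1 : ℝ))) ≤ 0 := by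
  have hθ : ContDiff ℝ 4 (fun x' => (v (-1) x' 2 : ℝ)) := contDiff_two_component hdec hcont hmild
  have hflat := hflatAll y hy0 hy
  obtain ⟨hii, hiii⟩ := quarticNormalForm_of_kernel hθ hvv hT2 hT1 hker
  have hexp := fun n z : ℝ => quarticForm_expansion_of_kernel (y := y) hθ hii hiii n z
  have hsign := fun n z : ℝ => fourthDeriv_diag_nonpos_of_flatHotPoint hdec hcont hmild hdiv hTH hne hhot hproper hσN hy0 hy hflat
    (n • ((-T 1) • EuclideanSpace.single 0 (1 : ℝ) + T 0 • EuclideanSpace.single 1 (1 : ℝ)) + z • (EuclideanSpace.single 2 (1 : ℝ)))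
  intro n z
  refine ⟨?_, hsign n z⟩
  rw [hexp n z]

/-- ★ **THE FLAT CELL ALONG A HOT ARC, BY NAME.**  Flat-cell binders VERBATIM («no compact isolated hot piece» is not needed: the arc itself supplies the hot sequences) and a differentiable map `γ : ℝ → P₀` through hot points with
unit speed (`‖deriv γ s‖ = 1`; e.g. the complete hot branch of the registered packages).  Then there is ONE `μ₀ ≤ 0` such that for EVERY `s`, with `T = deriv γ s`,
`ν = JT = (−T₁, T₀, 0)`, `y = γ s`: (K) the tangent is a kernel direction, `D⁴θ(y)[T,w,a,b] = 0`, and (E) the signed expansion of `kernelQuarticForm_of_flatHotPoint` holds with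
THIS `μ₀` — so `…QuarticDefinite.quartic_definite_iff` decides the LEAD g15 lever's definiteness at `γ(s)`: ⟺ `B₃(s)² < −μ₀P(s)²`. -/
theorem arcQuarticForm_of_flatHotArc (hdec : HasTypeITimeDecay C v) (hcont : ContinuousOn (uncurry v) (Iio (0 : ℝ) ×ˢ univ))
    (hmild : ∀ s t : ℝ, s < t → t < 0 → ∀ x, v t x = heatExtension (v s) (t - s) x - oseenDuhamel 1 s v v t x)
    (hdiv : ∀ t < 0, VectorCalculus.IsDivFree (v t))
    (hpol : ∀ s < 0, ∀ y, ⟪curl (v s) y, EuclideanSpace.single 2 1⟫_ℝ = 0)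
    (hTH : ∀ t < 0, ∀ x x' : EuclideanSpace ℝ (Fin 3), x 2 = x' 2 → ∀ b c : Fin 3, b ≠ 2 → c ≠ 2 →
      fderiv ℝ (v t) x (EuclideanSpace.single 2 1) b * fderiv ℝ (v t) x' (EuclideanSpace.single c 1) 2 =
        fderiv ℝ (v t) x' (EuclideanSpace.single 2 1) c * fderiv ℝ (v t) x (EuclideanSpace.single b 1) 2)
    (hne : v (-1) 0 2 ≠ 0) (hhot : ∀ t < 0, ∀ x, Real.sqrt (-t) * |v t x 2| ≤ |v (-1) 0 2|)
    (hproper : ∀ y ∈ {y : EuclideanSpace ℝ (Fin 3) | y 2 = 0 ∧ v (-1) y 2 = v (-1) 0 2}, ∀ r : ℝ, 0 < r →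
      ∃ y' : EuclideanSpace ℝ (Fin 3), y' 2 = 0 ∧ dist y' y < r ∧ v (-1) y' 2 ≠ v (-1) 0 2)
    {σ : ℝ} (hσN : σ * v (-1) 0 2 = |v (-1) 0 2|)
    (hflatAll : ∀ y : EuclideanSpace ℝ (Fin 3), y 2 = 0 → v (-1) y 2 = v (-1) 0 2 →
      fderiv ℝ (fderiv ℝ (fun x => σ * v (-1) x 2)) y (EuclideanSpace.single 0 1) (EuclideanSpace.single 0 1) +
        fderiv ℝ (fderiv ℝ (fun x => σ * v (-1) x 2)) y (EuclideanSpace.single 1 1) (EuclideanSpace.single 1 1) = 0)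
    {γ : ℝ → EuclideanSpace ℝ (Fin 3)} (hγd : Differentiable ℝ γ) (hγ2 : ∀ s, γ s 2 = 0) (hγv : ∀ s, v (-1) (γ s) 2 = v (-1) 0 2)
    (hunit : ∀ s, ‖deriv γ s‖ = 1) :
    ∃ μ₀ : ℝ, μ₀ ≤ 0 ∧ ∀ s : ℝ, ∀ T : EuclideanSpace ℝ (Fin 3), T = deriv γ s → ∀ y : EuclideanSpace ℝ (Fin 3), y = γ s →
      (∀ a b w : EuclideanSpace ℝ (Fin 3), fderiv ℝ (fderiv ℝ (fun x => fderiv ℝ (fderiv ℝ (fun x' => (v (-1) x' 2 : ℝ))) x a b)) y T w = 0) ∧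
      ∀ n z : ℝ,
        fderiv ℝ (fderiv ℝ (fun x => fderiv ℝ (fderiv ℝ (fun x' => (v (-1) x' 2 : ℝ))) x (n • ((-T 1) • EuclideanSpace.single 0 (1 : ℝ) + T 0 • EuclideanSpace.single 1 (1 : ℝ)) + z • (EuclideanSpace.single 2 (1 : ℝ))) (n • ((-T 1) • EuclideanSpace.single 0 (1 : ℝ) + T 0 • EuclideanSpace.single 1 (1 : ℝ)) + z • (EuclideanSpace.single 2 (1 : ℝ))))) y (n • ((-T 1) • EuclideanSpace.single 0 (1 : ℝ) + T 0 • EuclideanSpace.single 1 (1 : ℝ)) + z • (EuclideanSpace.single 2 (1 : ℝ))) (n • ((-T 1) • EuclideanSpace.single 0 (1 : ℝ) + T 0 • EuclideanSpace.single 1 (1 : ℝ)) + z • (EuclideanSpace.single 2 (1 : ℝ))) =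
          fderiv ℝ (fderiv ℝ (fun x => fderiv ℝ (fderiv ℝ (fun x' => (v (-1) x' 2 : ℝ))) x ((-T 1) • EuclideanSpace.single 0 (1 : ℝ) + T 0 • EuclideanSpace.single 1 (1 : ℝ)) ((-T 1) • EuclideanSpace.single 0 (1 : ℝ) + T 0 • EuclideanSpace.single 1 (1 : ℝ)))) y ((-T 1) • EuclideanSpace.single 0 (1 : ℝ) + T 0 • EuclideanSpace.single 1 (1 : ℝ)) ((-T 1) • EuclideanSpace.single 0 (1 : ℝ) + T 0 • EuclideanSpace.single 1 (1 : ℝ)) * (n ^ 4 - 6 * μ₀ * (n ^ 2 * z ^ 2) + μ₀ ^ 2 * z ^ 4) +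
            fderiv ℝ (fderiv ℝ (fun x => fderiv ℝ (fderiv ℝ (fun x' => (v (-1) x' 2 : ℝ))) x ((-T 1) • EuclideanSpace.single 0 (1 : ℝ) + T 0 • EuclideanSpace.single 1 (1 : ℝ)) ((-T 1) • EuclideanSpace.single 0 (1 : ℝ) + T 0 • EuclideanSpace.single 1 (1 : ℝ)))) y ((-T 1) • EuclideanSpace.single 0 (1 : ℝ) + T 0 • EuclideanSpace.single 1 (1 : ℝ)) (EuclideanSpace.single 2 (1 : ℝ)) * (4 * (n ^ 3 * z) - 4 * μ₀ * (n * z ^ 3)) ∧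
        σ * fderiv ℝ (fderiv ℝ (fun x => fderiv ℝ (fderiv ℝ (fun x' => (v (-1) x' 2 : ℝ))) x (n • ((-T 1) • EuclideanSpace.single 0 (1 : ℝ) + T 0 • EuclideanSpace.single 1 (1 : ℝ)) + z • (EuclideanSpace.single 2 (1 : ℝ))) (n • ((-T 1) • EuclideanSpace.single 0 (1 : ℝ) + T 0 • EuclideanSpace.single 1 (1 : ℝ)) + z • (EuclideanSpace.single 2 (1 : ℝ))))) y (n • ((-T 1) • EuclideanSpace.single 0 (1 : ℝ) + T 0 • EuclideanSpace.single 1 (1 : ℝ)) + z • (EuclideanSpace.single 2 (1 : ℝ))) (n • ((-T 1) • EuclideanSpace.single 0 (1 : ℝ) + T 0 • EuclideanSpace.single 1 (1 : ℝ)) + z • (EuclideanSpace.single 2 (1 : ℝ))) ≤ 0 := by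
  obtain ⟨μ₀, hμ0, hvv⟩ := hessian_vertVert_eq_smul_uniform hdec hcont hmild hdiv hpol hTH hne hhot hproper hσN
  refine ⟨μ₀, hμ0, fun s T hT y hyγ => ?_⟩
  subst hT
  subst hyγ
  have hy0 : γ s 2 = 0 := hγ2 s
  have hy : v (-1) (γ s) 2 = v (-1) 0 2 := hγv s
  have hT1 : ‖deriv γ s‖ = 1 := hunit s
  have hT0 : deriv γ s ≠ 0 := by
    intro h; rw [h, norm_zero] at hT1; exact zero_ne_one hT1
  have hT2 : deriv γ s 2 = 0 := by
    have hd : HasDerivAt (fun s' => γ s' 2) (deriv γ s 2) s :=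
      (EuclideanSpace.proj (𝕜 := ℝ) (2 : Fin 3)).hasFDerivAt.comp_hasDerivAt s (hγd s).hasDerivAt
    have hc : (fun s' => γ s' 2) = fun _ => (0 : ℝ) := funext fun s' => hγ2 s'
    rw [hc] at hd
    rw [← hd.deriv, deriv_const]
  have hker : ∀ a b w : EuclideanSpace ℝ (Fin 3),
      fderiv ℝ (fderiv ℝ (fun x => fderiv ℝ (fderiv ℝ (fun x' => (v (-1) x' 2 : ℝ))) x a b)) (γ s) (deriv γ s) w = 0 := fun a b w =>
    tangentKernel_of_hotArc hdec hcont hmild hdiv hTH hne hhot hproper hσN hflatAll hγ2 hγv (hγd s).hasDerivAt hT0 a b w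
  exact ⟨hker, kernelQuarticForm_of_flatHotPoint hdec hcont hmild hdiv hTH hne hhot hproper hσN hflatAll hy0 hy
    (hvv (γ s) hy0 hy (hflatAll _ hy0 hy)) hT2 hT1 hker⟩

end Summit.NavierStokesRegularity.NavierStokesRegularity.Theorems.PoloidalWindowDoorLrcModEntireTwistingTHFlatRidgeArcForm
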